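import Summits.Ventures.Crystal3D.Theorems.StickyWulffConstantCoaxialWallLawSeamJunkCapRows
import HarnessLib

/-!
# Cap-table row «TEN occupied slots» (closed lower half-dozen + one upper slot): at most ONE junk contact (crux `CoaxialWallLaw`, stmt-Ventures-19481;
# line `WallLedgerF`, skeleton 'CoaxialWallLawCertificates' v8.1, input `JunkCapBound` of `…SeamIncoherentAssembly`)

HONEST FRAMING. Venture `Summits/Ventures/Crystal3D` (cell `crystal3d-full`); one cap-table row for the crux `CoaxialWallLaw` (stmt-Ventures-19481,
`route-Ventures-StickyWulffConstant`), lane F T5b.  Nothing about the stubs is claimed; F-C1 not moved.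
THE FACT (kit j332782 probe: the free region has no separated pair off the tips): a unit direction at inner product `≤ 1/2` with the nine slots of the closed lower
half-dozen AND with the upper slot `8` has cubic coordinates `x₀ ≤ −c`, `x₁, x₂ ≥ 0` (`c = √2/2`), so two such directions make inner product `≥ c² = 1/2`, with
equality only at the two remaining tips `2, 6`.  Hence a core ball with ten core slots (nine + slot `8`) has AT MOST ONE junk contact (two junk balls would be
`1`-separated, i.e. at inner product `≤ 1/2`, hence both at tips — and tips cap core triangles):
* `TenFree`, `TenFree.coords`, `inner_ge_half_of_tenFree`, `mem_tips_of_tenFree_pair`;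
* **`junk_contacts_le_one_of_ten`** — the row in `JunkCapBound` form (frame slot `8` as the occupied upper slot; the other two cases are the same lemma in a
  rotated frame).
-/

noncomputable section

namespace Summit.Ventures.Crystal3D.Theorems

namespace TailResidue

open Summit.Ventures.Crystal3D Finset NearIdentity
open scoped InnerProductSpace

/-- A TEN-FREE direction: heal-free (nine slots of the closed lower half-dozen) and at inner product `≤ 1/2` with the upper slot `8`. -/
def TenFree (u : EuclideanSpace ℝ (Fin 3)) : Prop :=
  HealFree u ∧ ⟪u, slotSite 8⟫_ℝ ≤ 1 / 2

/-- **Coordinates of a ten-free direction**: `x₀ ≤ −√2/2`, `0 ≤ x₁`, `0 ≤ x₂`. -/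
theorem TenFree.coords {u : EuclideanSpace ℝ (Fin 3)} (h : TenFree u) :
    cubicCoords u 0 ≤ -(Real.sqrt 2 / 2) ∧ 0 ≤ cubicCoords u 1 ∧ 0 ≤ cubicCoords u 2 := by
  have hs : 0 < Real.sqrt 2 := by positivity
  have h2 : Real.sqrt 2 * Real.sqrt 2 = 2 := Real.mul_self_sqrt (by norm_num)
  obtain ⟨h01, h02, -, -, -, -⟩ := h.1.constraints
  have hT := h.1.axis_ge
  have e8 : cubicCoords u 1 + cubicCoords u 2 ≤ Real.sqrt 2 / 2 := by
    have := h.2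
    rw [inner_slotSite_right, div_le_iff₀ hs] at this
    simp only [slotInt, Matrix.cons_val_zero, Matrix.cons_val_one, Matrix.cons_val] at this
    norm_num at this
    nlinarith
  obtain ⟨h01a, -⟩ := abs_le.1 h01
  obtain ⟨h02a, -⟩ := abs_le.1 h02
  exact ⟨by linarith, by linarith, by linarith⟩

/-- **Two ten-free directions make inner product `≥ 1/2`.** -/
theorem inner_ge_half_of_tenFree {u u' : EuclideanSpace ℝ (Fin 3)} (h : TenFree u) (h' : TenFree u') : 1 / 2 ≤ ⟪u, u'⟫_ℝ := by
  obtain ⟨a0, a1, a2⟩ := h.coords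
  obtain ⟨b0, b1, b2⟩ := h'.coords
  have h2 : (Real.sqrt 2 / 2) * (Real.sqrt 2 / 2) = 1 / 2 := by
    have := Real.mul_self_sqrt (show (0 : ℝ) ≤ 2 by norm_num); nlinarith
  have hc0 : 0 < Real.sqrt 2 / 2 := by positivity
  rw [inner_eq_cubicCoords_three]
  have q0 : 0 ≤ (-(Real.sqrt 2 / 2) - cubicCoords u 0) * (-(Real.sqrt 2 / 2) - cubicCoords u' 0) := mul_nonneg (by linarith) (by linarith)
  have q1 : 0 ≤ (Real.sqrt 2 / 2) * (-(Real.sqrt 2 / 2) - cubicCoords u' 0) := mul_nonneg hc0.le (by linarith)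
  have q2 : 0 ≤ (Real.sqrt 2 / 2) * (-(Real.sqrt 2 / 2) - cubicCoords u 0) := mul_nonneg hc0.le (by linarith)
  nlinarith [mul_nonneg a1 b1, mul_nonneg a2 b2]

/-- **Two SEPARATED ten-free directions are both tips** (the two remaining upper slots). -/
theorem mem_tips_of_tenFree_pair {u u' : EuclideanSpace ℝ (Fin 3)} (h : TenFree u) (h' : TenFree u') (hsep : ⟪u, u'⟫_ℝ ≤ 1 / 2) :
    u ∈ healTips ∧ u' ∈ healTips := by
  obtain ⟨a0, a1, a2⟩ := h.coords
  obtain ⟨b0, b1, b2⟩ := h'.coords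
  have hc2 : (Real.sqrt 2 / 2) * (Real.sqrt 2 / 2) = 1 / 2 := by
    have := Real.mul_self_sqrt (show (0 : ℝ) ≤ 2 by norm_num); nlinarith
  have hc0 : 0 < Real.sqrt 2 / 2 := by positivity
  have hin := hsep
  rw [inner_eq_cubicCoords_three] at hin
  have p0 : 0 ≤ (-(Real.sqrt 2 / 2) - cubicCoords u 0) * (-(Real.sqrt 2 / 2) - cubicCoords u' 0) := mul_nonneg (by linarith) (by linarith)
  have p1 : 0 ≤ (Real.sqrt 2 / 2) * (-(Real.sqrt 2 / 2) - cubicCoords u' 0) := mul_nonneg hc0.le (by linarith)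
  have p2 : 0 ≤ (Real.sqrt 2 / 2) * (-(Real.sqrt 2 / 2) - cubicCoords u 0) := mul_nonneg hc0.le (by linarith)
  have p3 := mul_nonneg a1 b1
  have p4 := mul_nonneg a2 b2
  -- all slack vanishes
  have hsum0 : (Real.sqrt 2 / 2) * (-(Real.sqrt 2 / 2) - cubicCoords u 0) = 0 := by nlinarith
  have hsum0' : (Real.sqrt 2 / 2) * (-(Real.sqrt 2 / 2) - cubicCoords u' 0) = 0 := by nlinarith
  have ha0 : cubicCoords u 0 = -(Real.sqrt 2 / 2) := by
    rcases mul_eq_zero.1 hsum0 with h0 | h0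
    · exact absurd h0 hc0.ne'
    · linarith
  have hb0 : cubicCoords u' 0 = -(Real.sqrt 2 / 2) := by
    rcases mul_eq_zero.1 hsum0' with h0 | h0
    · exact absurd h0 hc0.ne'
    · linarith
  -- axis equality for each, then tips
  have hTu := h.1.axis_ge
  have hTu' := h'.1.axis_ge
  have hs : 0 < Real.sqrt 2 := by positivity
  have e8 : ∀ {w : EuclideanSpace ℝ (Fin 3)}, TenFree w → cubicCoords w 1 + cubicCoords w 2 ≤ Real.sqrt 2 / 2 := by
    intro w hw
    have := hw.2
    rw [inner_slotSite_right, div_le_iff₀ hs] at this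
    simp only [slotInt, Matrix.cons_val_zero, Matrix.cons_val_one, Matrix.cons_val] at this
    norm_num at this
    have h2 : Real.sqrt 2 * Real.sqrt 2 = 2 := Real.mul_self_sqrt (by norm_num)
    nlinarith
  have hTeq : -cubicCoords u 0 + cubicCoords u 1 + cubicCoords u 2 = 2 * (Real.sqrt 2 / 2) := by linarith [e8 h]
  have hTeq' : -cubicCoords u' 0 + cubicCoords u' 1 + cubicCoords u' 2 = 2 * (Real.sqrt 2 / 2) := by linarith [e8 h']
  exact ⟨h.1.mem_healTips_of_axis hTeq, h'.1.mem_healTips_of_axis hTeq'⟩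

/-! ### The row in `JunkCapBound` form -/

open scoped Classical in
/-- **ROW «ten slots ⇒ ≤ 1»**: a core ball `y` within `2` of the payer whose nine closed-lower-half positions AND the upper position `y + L(slotSite 8)` are CORE
balls is touched by at most one ball outside the core. -/
theorem junk_contacts_le_one_of_ten {X : Finset (EuclideanSpace ℝ (Fin 3))} (hX : ∀ p ∈ X, ∀ q ∈ X, p ≠ q → 1 ≤ dist p q)
    {z : EuclideanSpace ℝ (Fin 3)} (S : EuclideanSpace ℝ (Fin 3) ≃ₗᵢ[ℝ] EuclideanSpace ℝ (Fin 3)) {y : EuclideanSpace ℝ (Fin 3)}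
    (hy : y ∈ coreOf X z S) (hzy : dist z y ≤ 2) (L : EuclideanSpace ℝ (Fin 3) ≃ₗᵢ[ℝ] EuclideanSpace ℝ (Fin 3))
    (hocc : ∀ k ∈ lowerNine, y + L (slotSite k) ∈ coreOf X z S) (h8 : y + L (slotSite 8) ∈ coreOf X z S) :
    ((X \ coreOf X z S).filter fun x => dist y x = 1).card ≤ 1 := by
  set D := coreOf X z S with hD
  have hDX : D ⊆ X := coreOf_subset X z S
  -- every junk contact is ten-free (transported) and off-tip
  have hfree : ∀ x ∈ (X \ D).filter (fun x => dist y x = 1), TenFree (L.symm (x - y)) ∧ L.symm (x - y) ∉ healTips := by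
    intro x hx
    obtain ⟨hxXD, hyx⟩ := mem_filter.1 hx
    obtain ⟨hxX, hxD⟩ := mem_sdiff.1 hxXD
    have hne : ∀ k ∈ lowerNine, x ≠ y + L (slotSite k) := fun k hk h => hxD (h ▸ hocc k hk)
    have hf : HealFree (L.symm (x - y)) := healFree_of_contact hX L (fun k hk => hDX (hocc k hk)) hxX hyx hne
    have hxy : ‖x - y‖ = 1 := by rw [← dist_eq_norm, dist_comm]; exact hyx
    have h8' : ⟪L.symm (x - y), slotSite 8⟫_ℝ ≤ 1 / 2 := by
      have h1 : ⟪L.symm (x - y), slotSite 8⟫_ℝ = ⟪x - y, L (slotSite 8)⟫_ℝ := by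
        rw [← L.inner_map_map (L.symm (x - y)) (slotSite 8), LinearIsometryEquiv.apply_symm_apply]
      rw [h1]
      refine inner_le_half_of_norm_sub_ge_one hxy (by rw [LinearIsometryEquiv.norm_map]; exact norm_eq_one_of_mem_fccSlots (slotSite_mem 8)) ?_
      have : x - y - L (slotSite 8) = x - (y + L (slotSite 8)) := by abel
      rw [this, ← dist_eq_norm]
      exact hX x hxX _ (hDX h8) fun h => hxD (h ▸ h8)
    refine ⟨⟨hf, h8'⟩, fun ht => hxD ?_⟩
    have hxW : x ∈ X.filter fun x => dist z x ≤ 3 := mem_filter.2 ⟨hxX, by linarith [dist_triangle z y x]⟩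
    have hcap : CapsTriangleIn D x := by
      have := capsTriangleIn_of_tip L hy hocc ht
      rwa [LinearIsometryEquiv.apply_symm_apply, add_sub_cancel] at this
    exact mem_capClosure_of_capsTriangleIn (siteBallsAt_subset _ _ _) hxW hcap
  -- two junk contacts would be separated, hence both tips
  rw [card_le_one]
  intro a ha b hb
  by_contra hab
  obtain ⟨hfa, hta⟩ := hfree a ha
  obtain ⟨hfb, -⟩ := hfree b hb
  have haX : a ∈ X := (mem_sdiff.1 (mem_filter.1 ha).1).1
  have hbX : b ∈ X := (mem_sdiff.1 (mem_filter.1 hb).1).1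
  have hsep : ⟪L.symm (a - y), L.symm (b - y)⟫_ℝ ≤ 1 / 2 := by
    rw [L.symm.inner_map_map]
    refine inner_le_half_of_norm_sub_ge_one (by rw [← dist_eq_norm, dist_comm]; exact (mem_filter.1 ha).2)
      (by rw [← dist_eq_norm, dist_comm]; exact (mem_filter.1 hb).2) ?_
    have : a - y - (b - y) = a - b := by abel
    rw [this, ← dist_eq_norm]; exact hX a haX b hbX hab
  exact hta (mem_tips_of_tenFree_pair hfa hfb hsep).1

end TailResidue

end Summit.Ventures.Crystal3D.Theorems

end
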